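import Summits.HodgeConjecture.HodgeConjecture.Theorems.F0P3cStCharTSEllInnerSlotAlgebra      -- ★ FILE A (this seat): the 2 × 2 spectral-idempotent calculus
import Summits.HodgeConjecture.HodgeConjecture.Theorems.F0P3cStCharTSEllCartanCompactH        -- ★ p852403 (this lineage): `isCompact_centralizer_iff_not_mem_hyperbolicSet_H`; brings ★ HyperbolicSetEigen `mul_conjLocal_eq_one_of_not_mem_hyperbolicSet`
import Summits.HodgeConjecture.HodgeConjecture.Theorems.F0P3cStCharTSStableInvariantsH        -- ★ `conjLocal_finGammaTwo_mul_finGammaTwo'`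
import Summits.HodgeConjecture.HodgeConjecture.Theorems.F0P3cStCharTSFibreRealise            -- ★ `cmLocalForm_one_eq`; brings ★ `LocalNormFibreNonsplit` (`charpoly_endoEmbLocal`, `IsLocalGRegular.separable_finCharpolyTwo`) and ★ `LocalUnitaryRankTwoHilbertSection` (`cmLocalForm_two_eq`)
import Literature.NumberTheory.Automorphic.UnitaryGroupLocalFactors                           -- ★ `continuous_conjLocal`
import HarnessLib

/-!
# F0 · P3c · ROAD «ELL-INNER» (E2b) «SLOT-AUT», FILE B — EIGEN-COORDINATES AND THE SLOT PERMUTATIONS of a compact Cartan subgroup of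
# `H_v = U(Φ₂)(L⁺_v) × U(Φ₁)(L⁺_v)` (non-split `v`) [Rogawski1990 §3.6 L. 3.6.1, §3.7 Prop. 3.7.1, §12.5 pp. 184–185]

Cell `pub/hodgecm-mathlib`, crux H413 = `stmt-HodgeConjecture-24833` (lane `--supports … --as helper`), route HCCMUnconditional; ROAD «ELL-INNER» (map owner LH6-p03 (g7) «=»
2026-09-02T20:26:20Z; desk F0P3-plan (g18) GO 20:08:17Z; LEAD T14-44); brick (E2b), FILE B of the census `F0/P3a/F0P3a-p03/g27/e2b/CENSUS-E2b-SlotAut.v1.F0P3ap03g27.md`;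
seat F0P3a-p03 (g27).  THEOREMS ONLY (no definition ∕ instance ∕ notation ∕ named fact ∕ `sorry`); ★-only imports.

WHAT.  `T = Z_H(γ₀)`, `γ₀ = (g, u₀)` `G`-regular, at a finite place `v` of `L⁺` NON-SPLIT in `L` (`R := L ⊗ L⁺_v = ∏_{w ∣ v} L_w` is then a field: §0).
* §0 `isUnit_of_ne_zero` (non-split `v`), `eval_mul_X_sub_C_eq_zero_iff` (roots of `p · (X − c)`), `ne_of_separable_mul` (`(X − a)(X − b) · q` separable ⇒ `a ≠ b`).
* §1 `val_fst_mul_comm_of_mem` (the `U(Φ₂)`-part of `t ∈ T` commutes with `g`), `mul_conjLocal_eq_one_of_isRoot` (`T` COMPACT ⇒ every root of `χ_g` in `R` is NORM-ONE — ★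
  `isCompact_centralizer_iff_not_mem_hyperbolicSet_H` ∘ ★ `mul_conjLocal_eq_one_of_not_mem_hyperbolicSet`), `snd_val_eq_smul_one` (the `U(Φ₁)`-part is the scalar `finGammaTwo`).
* §2 **`exists_swapEquiv`** — the heart: given a self-adjoint rank-one idempotent `P ∈ M₂(R)` commuting with everything that commutes with `g` (in use: the spectral idempotents
  `P₁ = δ⁻¹(g − a₂)`, `P₂ = 1 − P₁` of a TYPE-(1) `g`), there is a continuous group automorphism `e : ↥T ≃ₜ* ↥T` («SLOT PERMUTATION») with
  `(e t).1 = u(t) • P + β(t) • (1 − P)` and `finGammaTwo (e t) = α(t)`, where `t.1 = α(t) • P + β(t) • (1 − P)`, `α = tr(P t.1)`, `β = tr((1 − P) t.1)`, `u = finGammaTwo t` —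
  i.e. `e` SWAPS the `P`-eigenvalue with the `U(Φ₁)`-coordinate; it is an involution; NEVER an `H_v`-conjugation (census wall (d)(5)).  Also `fst_val_eq_coords` (the structure
  equation) and `charpoly_endoEmbLocal_eq_prod` (`charpoly ι(t) = (X − α)(X − β)(X − u)`).
* §3 **`exists_slots_of_isRoot`** (TYPE (1): `χ_g` has a root in `R`): three slots `e₀ = refl`, `e₁`, `e₂` with (X) `charpoly ι(e_u t) = charpoly ι(t)`, (D) distinct
  `U(Φ₁)`-coordinates at `G`-regular `t`, (R) the `U(Φ₁)`-coordinates of the slots are EXACTLY the roots of `charpoly ι(t)` in `R`; **`roots_of_not_isRoot`** (TYPE (2): no root):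
  at a `G`-regular `t ∈ T` the only root of `charpoly ι(t)` in `R` is `finGammaTwo t` (a root of `χ_{t.1}` would split `χ_g` via the structure equation for `g` against the
  spectral idempotent of `t.1`).
HONEST LABEL: count-neutral; `𝔇.Prop1252` stays a PRINTED consequent of `hBlock′` until a ★ rider; HC_CM is proved only modulo the printed citations until rung 0 closes.

## References
* [Rogawski1990] J. D. Rogawski, *Automorphic Representations of Unitary Groups in Three Variables*, Ann. of Math. Stud. 123 (1990): §3.6 pp. 28–31 (the tori of `U(2)` as unit groups
  of `F[γ]`; Lemma 3.6.1), §3.7 Prop. 3.7.1 p. 31 (`Ω_F(T, G)` vs `Ω(T, H)`), §12.5 pp. 184–185 (the change of variables `γ ↦ w γ w⁻¹` in the proof of Prop. 12.5.2).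
-/

set_option autoImplicit false
-- the mandated namespace has the single-problem summit's repeated segment (`HodgeConjecture.HodgeConjecture`)
set_option linter.dupNamespace false

noncomputable section

open Matrix Polynomial NumberField IsDedekindDomain Topology
open Literature.NumberTheory.Automorphic Literature.NumberTheory.Automorphic.UnitaryGroup Literature.NumberTheory.Rogawski1990
open Summit.HodgeConjecture.HodgeConjecture.Cruxes.H413.F0P3cStCharTSEllInnerSlotAlgebra

namespace Summit.HodgeConjecture.HodgeConjecture.Cruxes.H413.F0P3cStCharTSEllInnerSlotCoords

variable (L : Type) [Field L] [NumberField L] [IsCMField L] (v : HeightOneSpectrum (𝓞 ↥(maximalRealSubfield L)))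

/-! ## §0 The local ring at a non-split place is a field -/

/-- At a non-split `v` there is ONE place above `v`, so a non-zero `x ∈ ∏_{w ∣ v} L_w` is a unit. [cite: Rogawski1990, §3.6 p. 28] -/
theorem isUnit_of_ne_zero (hns : ∀ w : PlacesOver L v, IsCMField.complexConj L • w.1 = w.1) {x : UnitaryGroup.LocalRing L v} (hx : x ≠ 0) : IsUnit x := by
  obtain ⟨w⟩ := (inferInstance : Nonempty (PlacesOver L v))
  haveI : Subsingleton (PlacesOver L v) := PlacesOver.subsingleton_of_smul_eq (IsCMField.complexConj L) (IsCMField.complexConj_ne_one L) w (hns w)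
  refine isUnit_localRing_of_forall_apply_ne_zero fun w' hw' => hx (funext fun w'' => ?_)
  rw [Subsingleton.elim w'' w', hw', Pi.zero_apply]

/-- `x y = 0 ⇒ x = 0 ∨ y = 0` in `∏_{w ∣ v} L_w` at a non-split `v`. [cite: Rogawski1990, §3.6 p. 28] -/
theorem eq_zero_or_eq_zero_of_mul_eq_zero (hns : ∀ w : PlacesOver L v, IsCMField.complexConj L • w.1 = w.1) {x y : UnitaryGroup.LocalRing L v} (h : x * y = 0) : x = 0 ∨ y = 0 := by
  by_cases hx : x = 0
  · exact Or.inl hx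
  · obtain ⟨u, rfl⟩ := isUnit_of_ne_zero L v hns hx
    exact Or.inr (by simpa using congrArg (fun z => (↑u⁻¹ : UnitaryGroup.LocalRing L v) * z) h)

/-- Roots of `p · (X − c)` at a non-split `v`: `r` is a root iff `p(r) = 0` or `r = c`. [cite: Rogawski1990, §4.3 p. 42] -/
theorem isRoot_mul_X_sub_C_iff (hns : ∀ w : PlacesOver L v, IsCMField.complexConj L • w.1 = w.1) (p : (UnitaryGroup.LocalRing L v)[X]) (c r : UnitaryGroup.LocalRing L v) :
    (p * (X - C c)).IsRoot r ↔ p.IsRoot r ∨ r = c := by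
  rw [IsRoot, eval_mul, eval_sub, eval_X, eval_C, IsRoot]
  constructor
  · intro h
    rcases eq_zero_or_eq_zero_of_mul_eq_zero L v hns h with h | h
    · exact Or.inl h
    · exact Or.inr (sub_eq_zero.1 h)
  · rintro (h | rfl)
    · rw [h, zero_mul]
    · rw [sub_self, mul_zero]

/-- Roots of `(X − a)(X − b)`: `r = a ∨ r = b` (non-split `v`). [folklore] -/
theorem isRoot_X_sub_C_mul_X_sub_C_iff (hns : ∀ w : PlacesOver L v, IsCMField.complexConj L • w.1 = w.1) (a b r : UnitaryGroup.LocalRing L v) :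
    ((X - C a) * (X - C b)).IsRoot r ↔ r = a ∨ r = b := by
  rw [isRoot_mul_X_sub_C_iff L v hns, IsRoot, eval_sub, eval_X, eval_C, sub_eq_zero]

omit [IsCMField L] in
/-- A separable `(X − a) · q` with `q(a) = 0` is impossible; hence `(X − a)(X − b) · q` separable forces `a ≠ b`, and `(X − a) q` separable with `q = (X − b) q′` forces `a ≠ b`.
Stated as: `((X − C a) * (X − C a) * q)` is never separable. [folklore] -/
theorem not_separable_X_sub_C_sq_mul (a : UnitaryGroup.LocalRing L v) (q : (UnitaryGroup.LocalRing L v)[X]) : ¬ ((X - C a) * (X - C a) * q).Separable := by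
  haveI : Nontrivial (UnitaryGroup.LocalRing L v) := UnitaryGroup.nontrivial_localRing L v
  intro h
  have h2 := (h.of_mul_left).squarefree (X - C a) ⟨1, by ring⟩
  exact (Polynomial.not_isUnit_X_sub_C a) h2

/-! ## §1 A Cartan subgroup `T = Z_H(γ₀)`: commutation, norm-one roots, the `U(Φ₁)`-coordinate -/

section Cartan

variable {L v}
variable {γ₀ : (UnitaryGroup.cmDatum L 2 (Matrix.of fun i j : Fin 2 => if i.val + j.val + 1 = 2 then (1 : L) else 0)).Local v × (UnitaryGroup.cmDatum L 1 (Matrix.of fun i j : Fin 1 => if i.val + j.val + 1 = 1 then (1 : L) else 0)).Local v} {T : Subgroup ((UnitaryGroup.cmDatum L 2 (Matrix.of fun i j : Fin 2 => if i.val + j.val + 1 = 2 then (1 : L) else 0)).Local v × (UnitaryGroup.cmDatum L 1 (Matrix.of fun i j : Fin 1 => if i.val + j.val + 1 = 1 then (1 : L) else 0)).Local v)}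

/-- The `U(Φ₂)`-matrix of `t ∈ T = Z_H(γ₀)` commutes with that of `γ₀`. [cite: Rogawski1990, §3.1 p. 19] -/
theorem val_fst_mul_comm_of_mem (hT : T = Subgroup.centralizer ({γ₀} : Set ((UnitaryGroup.cmDatum L 2 (Matrix.of fun i j : Fin 2 => if i.val + j.val + 1 = 2 then (1 : L) else 0)).Local v × (UnitaryGroup.cmDatum L 1 (Matrix.of fun i j : Fin 1 => if i.val + j.val + 1 = 1 then (1 : L) else 0)).Local v))) (t : ↥T) :
    ((t : (UnitaryGroup.cmDatum L 2 (Matrix.of fun i j : Fin 2 => if i.val + j.val + 1 = 2 then (1 : L) else 0)).Local v × (UnitaryGroup.cmDatum L 1 (Matrix.of fun i j : Fin 1 => if i.val + j.val + 1 = 1 then (1 : L) else 0)).Local v).1.val : GL (Fin 2) (UnitaryGroup.LocalRing L v)).val * (γ₀.1.val : GL (Fin 2) (UnitaryGroup.LocalRing L v)).val =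
      (γ₀.1.val : GL (Fin 2) (UnitaryGroup.LocalRing L v)).val * ((t : (UnitaryGroup.cmDatum L 2 (Matrix.of fun i j : Fin 2 => if i.val + j.val + 1 = 2 then (1 : L) else 0)).Local v × (UnitaryGroup.cmDatum L 1 (Matrix.of fun i j : Fin 1 => if i.val + j.val + 1 = 1 then (1 : L) else 0)).Local v).1.val : GL (Fin 2) (UnitaryGroup.LocalRing L v)).val := by
  have ht : (t : (UnitaryGroup.cmDatum L 2 (Matrix.of fun i j : Fin 2 => if i.val + j.val + 1 = 2 then (1 : L) else 0)).Local v × (UnitaryGroup.cmDatum L 1 (Matrix.of fun i j : Fin 1 => if i.val + j.val + 1 = 1 then (1 : L) else 0)).Local v) ∈ Subgroup.centralizer ({γ₀} : Set ((UnitaryGroup.cmDatum L 2 (Matrix.of fun i j : Fin 2 => if i.val + j.val + 1 = 2 then (1 : L) else 0)).Local v × (UnitaryGroup.cmDatum L 1 (Matrix.of fun i j : Fin 1 => if i.val + j.val + 1 = 1 then (1 : L) else 0)).Local v)) := hT ▸ t.2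
  have h := (Subgroup.mem_centralizer_singleton_iff.1 ht)
  have h1 : (t : (UnitaryGroup.cmDatum L 2 (Matrix.of fun i j : Fin 2 => if i.val + j.val + 1 = 2 then (1 : L) else 0)).Local v × (UnitaryGroup.cmDatum L 1 (Matrix.of fun i j : Fin 1 => if i.val + j.val + 1 = 1 then (1 : L) else 0)).Local v).1 * γ₀.1 = γ₀.1 * (t : (UnitaryGroup.cmDatum L 2 (Matrix.of fun i j : Fin 2 => if i.val + j.val + 1 = 2 then (1 : L) else 0)).Local v × (UnitaryGroup.cmDatum L 1 (Matrix.of fun i j : Fin 1 => if i.val + j.val + 1 = 1 then (1 : L) else 0)).Local v).1 := by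
    have := congrArg Prod.fst h
    simpa only [Prod.fst_mul] using this
  have key : ((t : (UnitaryGroup.cmDatum L 2 (Matrix.of fun i j : Fin 2 => if i.val + j.val + 1 = 2 then (1 : L) else 0)).Local v × (UnitaryGroup.cmDatum L 1 (Matrix.of fun i j : Fin 1 => if i.val + j.val + 1 = 1 then (1 : L) else 0)).Local v).1.val : GL (Fin 2) (UnitaryGroup.LocalRing L v)).val * (γ₀.1.val : GL (Fin 2) (UnitaryGroup.LocalRing L v)).val = (((t : (UnitaryGroup.cmDatum L 2 (Matrix.of fun i j : Fin 2 => if i.val + j.val + 1 = 2 then (1 : L) else 0)).Local v × (UnitaryGroup.cmDatum L 1 (Matrix.of fun i j : Fin 1 => if i.val + j.val + 1 = 1 then (1 : L) else 0)).Local v).1 * γ₀.1).val : GL (Fin 2) (UnitaryGroup.LocalRing L v)).val := rfl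
  have key' : (γ₀.1.val : GL (Fin 2) (UnitaryGroup.LocalRing L v)).val * ((t : (UnitaryGroup.cmDatum L 2 (Matrix.of fun i j : Fin 2 => if i.val + j.val + 1 = 2 then (1 : L) else 0)).Local v × (UnitaryGroup.cmDatum L 1 (Matrix.of fun i j : Fin 1 => if i.val + j.val + 1 = 1 then (1 : L) else 0)).Local v).1.val : GL (Fin 2) (UnitaryGroup.LocalRing L v)).val = ((γ₀.1 * (t : (UnitaryGroup.cmDatum L 2 (Matrix.of fun i j : Fin 2 => if i.val + j.val + 1 = 2 then (1 : L) else 0)).Local v × (UnitaryGroup.cmDatum L 1 (Matrix.of fun i j : Fin 1 => if i.val + j.val + 1 = 1 then (1 : L) else 0)).Local v).1).val : GL (Fin 2) (UnitaryGroup.LocalRing L v)).val := rfl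
  rw [key, key', h1]

/-- **COMPACT ⇒ NORM-ONE ROOTS**: if `T = Z_H(γ₀)` is compact (`γ₀` `G`-regular, `v` non-split), every root `a ∈ R` of `χ_g` (`g = γ₀.1`) has `a σ(a) = 1` — `ι_v γ₀ ∉ Ω`
(★ `isCompact_centralizer_iff_not_mem_hyperbolicSet_H`) and ★ `mul_conjLocal_eq_one_of_not_mem_hyperbolicSet` on `charpoly ι_v γ₀ = χ_g · (X − u₀)`.
[cite: Rogawski1990, §3.6 pp. 28–31; §12.5 p. 182] -/
theorem mul_conjLocal_eq_one_of_isRoot (hns : ∀ w : PlacesOver L v, IsCMField.complexConj L • w.1 = w.1) (hγ₀ : IsLocalGRegular L v γ₀)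
    (hT : T = Subgroup.centralizer ({γ₀} : Set ((UnitaryGroup.cmDatum L 2 (Matrix.of fun i j : Fin 2 => if i.val + j.val + 1 = 2 then (1 : L) else 0)).Local v × (UnitaryGroup.cmDatum L 1 (Matrix.of fun i j : Fin 1 => if i.val + j.val + 1 = 1 then (1 : L) else 0)).Local v))) (hcpt : IsCompact (T : Set ((UnitaryGroup.cmDatum L 2 (Matrix.of fun i j : Fin 2 => if i.val + j.val + 1 = 2 then (1 : L) else 0)).Local v × (UnitaryGroup.cmDatum L 1 (Matrix.of fun i j : Fin 1 => if i.val + j.val + 1 = 1 then (1 : L) else 0)).Local v))) {a : UnitaryGroup.LocalRing L v} (ha : (finCharpolyTwo L v γ₀).IsRoot a) :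
    a * UnitaryGroup.conjLocal L (IsCMField.complexConj L) v a = 1 := by
  subst hT
  have hΩ := (F0P3cStCharTSEllCartanCompactH.isCompact_centralizer_iff_not_mem_hyperbolicSet_H L v hns γ₀ hγ₀).1 hcpt
  refine F0P3cStCharTSHyperbolicSetEigen.mul_conjLocal_eq_one_of_not_mem_hyperbolicSet L v hns hγ₀ hΩ ?_
  change (((endoEmbLocal L v γ₀).val.val : Matrix (Fin 3) (Fin 3) (UnitaryGroup.LocalRing L v)).charpoly).IsRoot a
  rw [charpoly_endoEmbLocal, IsRoot, eval_mul, ha.eq_zero, zero_mul]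

/-- The `U(Φ₁)`-matrix of `a ∈ H_v` is the scalar `finGammaTwo a`. [cite: Rogawski1990, §4.9 p. 55] -/
theorem snd_val_eq_smul_one (a : (UnitaryGroup.cmDatum L 2 (Matrix.of fun i j : Fin 2 => if i.val + j.val + 1 = 2 then (1 : L) else 0)).Local v × (UnitaryGroup.cmDatum L 1 (Matrix.of fun i j : Fin 1 => if i.val + j.val + 1 = 1 then (1 : L) else 0)).Local v) :
    (a.2.val : GL (Fin 1) (UnitaryGroup.LocalRing L v)).val = finGammaTwo L v a • (1 : Matrix (Fin 1) (Fin 1) (UnitaryGroup.LocalRing L v)) := by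
  ext i j
  fin_cases i; fin_cases j
  simp [finGammaTwo]

/-- Membership of the scalar `x • 1` in `U(Φ₁)(L⁺_v)` for norm-one `x`. [cite: Rogawski1990, §4.9 p. 55] -/
theorem smul_one_mem_local_one {x : UnitaryGroup.LocalRing L v} (hx : UnitaryGroup.conjLocal L (IsCMField.complexConj L) v x * x = 1) (u : GL (Fin 1) (UnitaryGroup.LocalRing L v)) (hu : u.val = x • (1 : Matrix (Fin 1) (Fin 1) (UnitaryGroup.LocalRing L v))) :
    u ∈ unitaryGroupOfForm (UnitaryGroup.conjLocal L (IsCMField.complexConj L) v) (UnitaryGroup.cmLocalForm L 1 v) := by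
  rw [mem_unitaryGroupOfForm_iff, hu, F0P3cStCharTSFibreRealise.cmLocalForm_one_eq]
  apply Matrix.ext
  intro i j
  fin_cases i; fin_cases j
  simp only [Fin.zero_eta, Fin.isValue, Matrix.mul_apply, Fin.sum_univ_one, Matrix.transpose_apply, Matrix.map_apply, Matrix.smul_apply, Matrix.one_apply_eq, smul_eq_mul,
    mul_one, Matrix.of_apply, Matrix.cons_val_zero]
  exact hx

end Cartan

/-! ## §2 The swap automorphism attached to a self-adjoint rank-one idempotent commuting with `g` -/

section Swap

variable {L v}

/-- The structure equation of `T`: with `P` a rank-one idempotent commuting with everything commuting with `g`, the `U(Φ₂)`-matrix `m` of every `t ∈ T = Z_H(γ₀)` is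
`tr(P m) • P + tr((1 − P) m) • (1 − P)`. [cite: Rogawski1990, §3.6 p. 28] -/
theorem fst_val_eq_coords {γ₀ : (UnitaryGroup.cmDatum L 2 (Matrix.of fun i j : Fin 2 => if i.val + j.val + 1 = 2 then (1 : L) else 0)).Local v × (UnitaryGroup.cmDatum L 1 (Matrix.of fun i j : Fin 1 => if i.val + j.val + 1 = 1 then (1 : L) else 0)).Local v} {T : Subgroup ((UnitaryGroup.cmDatum L 2 (Matrix.of fun i j : Fin 2 => if i.val + j.val + 1 = 2 then (1 : L) else 0)).Local v × (UnitaryGroup.cmDatum L 1 (Matrix.of fun i j : Fin 1 => if i.val + j.val + 1 = 1 then (1 : L) else 0)).Local v)} (hT : T = Subgroup.centralizer ({γ₀} : Set ((UnitaryGroup.cmDatum L 2 (Matrix.of fun i j : Fin 2 => if i.val + j.val + 1 = 2 then (1 : L) else 0)).Local v × (UnitaryGroup.cmDatum L 1 (Matrix.of fun i j : Fin 1 => if i.val + j.val + 1 = 1 then (1 : L) else 0)).Local v)))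
    {P : Matrix (Fin 2) (Fin 2) (UnitaryGroup.LocalRing L v)} (hP : P * P = P) (htrP : P.trace = 1)
    (hPc : ∀ m : Matrix (Fin 2) (Fin 2) (UnitaryGroup.LocalRing L v), m * (γ₀.1.val : GL (Fin 2) (UnitaryGroup.LocalRing L v)).val = (γ₀.1.val : GL (Fin 2) (UnitaryGroup.LocalRing L v)).val * m → m * P = P * m) (t : ↥T) :
    ((t : (UnitaryGroup.cmDatum L 2 (Matrix.of fun i j : Fin 2 => if i.val + j.val + 1 = 2 then (1 : L) else 0)).Local v × (UnitaryGroup.cmDatum L 1 (Matrix.of fun i j : Fin 1 => if i.val + j.val + 1 = 1 then (1 : L) else 0)).Local v).1.val : GL (Fin 2) (UnitaryGroup.LocalRing L v)).val =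
      (P * ((t : (UnitaryGroup.cmDatum L 2 (Matrix.of fun i j : Fin 2 => if i.val + j.val + 1 = 2 then (1 : L) else 0)).Local v × (UnitaryGroup.cmDatum L 1 (Matrix.of fun i j : Fin 1 => if i.val + j.val + 1 = 1 then (1 : L) else 0)).Local v).1.val : GL (Fin 2) (UnitaryGroup.LocalRing L v)).val).trace • P + ((1 - P) * ((t : (UnitaryGroup.cmDatum L 2 (Matrix.of fun i j : Fin 2 => if i.val + j.val + 1 = 2 then (1 : L) else 0)).Local v × (UnitaryGroup.cmDatum L 1 (Matrix.of fun i j : Fin 1 => if i.val + j.val + 1 = 1 then (1 : L) else 0)).Local v).1.val : GL (Fin 2) (UnitaryGroup.LocalRing L v)).val).trace • (1 - P) :=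
  eq_trace_smul_add_trace_smul_of_commute hP htrP (hPc _ (val_fst_mul_comm_of_mem hT t))

/-- `charpoly ι_v(t) = (X − α)(X − β)(X − u)` in the `P`-coordinates `α = tr(P t.1)`, `β = tr((1 − P) t.1)`, `u = finGammaTwo t` (non-split `v`).
[cite: Rogawski1990, §3.6 p. 28; §4.3 p. 42] -/
theorem charpoly_endoEmbLocal_eq_prod {γ₀ : (UnitaryGroup.cmDatum L 2 (Matrix.of fun i j : Fin 2 => if i.val + j.val + 1 = 2 then (1 : L) else 0)).Local v × (UnitaryGroup.cmDatum L 1 (Matrix.of fun i j : Fin 1 => if i.val + j.val + 1 = 1 then (1 : L) else 0)).Local v} {T : Subgroup ((UnitaryGroup.cmDatum L 2 (Matrix.of fun i j : Fin 2 => if i.val + j.val + 1 = 2 then (1 : L) else 0)).Local v × (UnitaryGroup.cmDatum L 1 (Matrix.of fun i j : Fin 1 => if i.val + j.val + 1 = 1 then (1 : L) else 0)).Local v)} (hT : T = Subgroup.centralizer ({γ₀} : Set ((UnitaryGroup.cmDatum L 2 (Matrix.of fun i j : Fin 2 => if i.val + j.val + 1 = 2 then (1 : L) else 0)).Local v ×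 (UnitaryGroup.cmDatum L 1 (Matrix.of fun i j : Fin 1 => if i.val + j.val + 1 = 1 then (1 : L) else 0)).Local v)))
    {P : Matrix (Fin 2) (Fin 2) (UnitaryGroup.LocalRing L v)} (hP : P * P = P) (htrP : P.trace = 1)
    (hPc : ∀ m : Matrix (Fin 2) (Fin 2) (UnitaryGroup.LocalRing L v), m * (γ₀.1.val : GL (Fin 2) (UnitaryGroup.LocalRing L v)).val = (γ₀.1.val : GL (Fin 2) (UnitaryGroup.LocalRing L v)).val * m → m * P = P * m) (t : ↥T) :
    ((endoEmbLocal L v (t : (UnitaryGroup.cmDatum L 2 (Matrix.of fun i j : Fin 2 => if i.val + j.val + 1 = 2 then (1 : L) else 0)).Local v × (UnitaryGroup.cmDatum L 1 (Matrix.of fun i j : Fin 1 => if i.val + j.val + 1 = 1 then (1 : L) else 0)).Local v)).val.val : Matrix (Fin 3) (Fin 3) (UnitaryGroup.LocalRing L v)).charpoly =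
      (X - C (P * ((t : (UnitaryGroup.cmDatum L 2 (Matrix.of fun i j : Fin 2 => if i.val + j.val + 1 = 2 then (1 : L) else 0)).Local v × (UnitaryGroup.cmDatum L 1 (Matrix.of fun i j : Fin 1 => if i.val + j.val + 1 = 1 then (1 : L) else 0)).Local v).1.val : GL (Fin 2) (UnitaryGroup.LocalRing L v)).val).trace) * (X - C ((1 - P) * ((t : (UnitaryGroup.cmDatum L 2 (Matrix.of fun i j : Fin 2 => if i.val + j.val + 1 = 2 then (1 : L) else 0)).Local v × (UnitaryGroup.cmDatum L 1 (Matrix.of fun i j : Fin 1 => if i.val + j.val + 1 = 1 then (1 : L) else 0)).Local v).1.val : GL (Fin 2) (UnitaryGroup.LocalRing L v)).val).trace) *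
        (X - C (finGammaTwo L v (t : (UnitaryGroup.cmDatum L 2 (Matrix.of fun i j : Fin 2 => if i.val + j.val + 1 = 2 then (1 : L) else 0)).Local v × (UnitaryGroup.cmDatum L 1 (Matrix.of fun i j : Fin 1 => if i.val + j.val + 1 = 1 then (1 : L) else 0)).Local v))) := by
  haveI : Nontrivial (UnitaryGroup.LocalRing L v) := UnitaryGroup.nontrivial_localRing L v
  rw [charpoly_endoEmbLocal]
  unfold finCharpolyTwo
  conv_lhs => rw [fst_val_eq_coords hT hP htrP hPc t]
  rw [charpoly_smul_add_smul hP htrP]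

set_option maxHeartbeats 1600000 in
-- a long structure-building proof on the CM local carriers
/-- **THE SWAP AUTOMORPHISM OF A COMPACT CARTAN SUBGROUP.**  `T = Z_H(γ₀)` compact, `γ₀ = (g, u₀)` `G`-regular, `v` non-split; `P ∈ M₂(R)` a rank-one idempotent (`P² = P`,
`tr P = 1`), SELF-ADJOINT for `Φ₂` (`(σ P)ᵀ Φ₂ = Φ₂ P`) and commuting with the commutant of `g`.  Writing `t.1 = α(t) P + β(t) (1 − P)`, `u(t) = finGammaTwo t`, all three
coordinates norm-one, there is a CONTINUOUS GROUP AUTOMORPHISM `e : ↥T ≃ₜ* ↥T` with **`(e t).1 = u(t) P + β(t) (1 − P)` and `finGammaTwo (e t) = α(t)`** (swap `α ↔ u`); `e` is an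
involution.  This realises one of the two non-trivial cosets of `Ω_F(T, G) ∕ Ω_F(T, H)` as an abstract automorphism of the torus — not a conjugation in `H_v`.
[cite: Rogawski1990, §3.7 Prop. 3.7.1 p. 31; §12.5 pp. 184–185] -/
theorem exists_swapEquiv {γ₀ : (UnitaryGroup.cmDatum L 2 (Matrix.of fun i j : Fin 2 => if i.val + j.val + 1 = 2 then (1 : L) else 0)).Local v × (UnitaryGroup.cmDatum L 1 (Matrix.of fun i j : Fin 1 => if i.val + j.val + 1 = 1 then (1 : L) else 0)).Local v} {T : Subgroup ((UnitaryGroup.cmDatum L 2 (Matrix.of fun i j : Fin 2 => if i.val + j.val + 1 = 2 then (1 : L) else 0)).Local v × (UnitaryGroup.cmDatum L 1 (Matrix.of fun i j : Fin 1 => if i.val + j.val + 1 = 1 then (1 : L) else 0)).Local v)} (hT : T = Subgroup.centralizer ({γ₀} : Set ((UnitaryGroup.cmDatum L 2 (Matrix.of fun i j : Fin 2 => if i.val + j.val + 1 = 2 then (1 : L) else 0)).Local v × (UnitaryGroup.cmDatum L 1 (Matrix.of fun i j : Fin 1 => if i.val + j.val + 1 = 1 then (1 : L) else 0)).Local v)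))
    {P : Matrix (Fin 2) (Fin 2) (UnitaryGroup.LocalRing L v)} (hP : P * P = P) (htrP : P.trace = 1) (hadj : (P.map (UnitaryGroup.conjLocal L (IsCMField.complexConj L) v))ᵀ * UnitaryGroup.cmLocalForm L 2 v = UnitaryGroup.cmLocalForm L 2 v * P)
    (hPc : ∀ m : Matrix (Fin 2) (Fin 2) (UnitaryGroup.LocalRing L v), m * (γ₀.1.val : GL (Fin 2) (UnitaryGroup.LocalRing L v)).val = (γ₀.1.val : GL (Fin 2) (UnitaryGroup.LocalRing L v)).val * m → m * P = P * m)
    (hPg : P * (γ₀.1.val : GL (Fin 2) (UnitaryGroup.LocalRing L v)).val = (γ₀.1.val : GL (Fin 2) (UnitaryGroup.LocalRing L v)).val * P) :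
    ∃ e : ↥T ≃ₜ* ↥T, ∀ t : ↥T,
      (((e t : ↥T) : (UnitaryGroup.cmDatum L 2 (Matrix.of fun i j : Fin 2 => if i.val + j.val + 1 = 2 then (1 : L) else 0)).Local v × (UnitaryGroup.cmDatum L 1 (Matrix.of fun i j : Fin 1 => if i.val + j.val + 1 = 1 then (1 : L) else 0)).Local v).1.val : GL (Fin 2) (UnitaryGroup.LocalRing L v)).val =
          finGammaTwo L v (t : (UnitaryGroup.cmDatum L 2 (Matrix.of fun i j : Fin 2 => if i.val + j.val + 1 = 2 then (1 : L) else 0)).Local v × (UnitaryGroup.cmDatum L 1 (Matrix.of fun i j : Fin 1 => if i.val + j.val + 1 = 1 then (1 : L) else 0)).Local v) • P + ((1 - P) * ((t : (UnitaryGroup.cmDatum L 2 (Matrix.of fun i j : Fin 2 => if i.val + j.val + 1 = 2 then (1 : L) else 0)).Local v × (UnitaryGroup.cmDatum L 1 (Matrix.of fun i j : Fin 1 => if i.val + j.val + 1 = 1 then (1 : L) else 0)).Local v).1.val : GL (Fin 2) (UnitaryGroup.LocalRing L v)).val).trace • (1 - P) ∧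
      finGammaTwo L v ((e t : ↥T) : (UnitaryGroup.cmDatum L 2 (Matrix.of fun i j : Fin 2 => if i.val + j.val + 1 = 2 then (1 : L) else 0)).Local v × (UnitaryGroup.cmDatum L 1 (Matrix.of fun i j : Fin 1 => if i.val + j.val + 1 = 1 then (1 : L) else 0)).Local v) = (P * ((t : (UnitaryGroup.cmDatum L 2 (Matrix.of fun i j : Fin 2 => if i.val + j.val + 1 = 2 then (1 : L) else 0)).Local v × (UnitaryGroup.cmDatum L 1 (Matrix.of fun i j : Fin 1 => if i.val + j.val + 1 = 1 then (1 : L) else 0)).Local v).1.val : GL (Fin 2) (UnitaryGroup.LocalRing L v)).val).trace := by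
  haveI : Nontrivial (UnitaryGroup.LocalRing L v) := UnitaryGroup.nontrivial_localRing L v
  have hJ : IsUnit (UnitaryGroup.cmLocalForm L 2 v).det := by
    rw [cmLocalForm_two_eq, Matrix.det_fin_two_of]; norm_num
  -- coordinates and their norm-one property
  have hcoords := fun t : ↥T => fst_val_eq_coords hT hP htrP hPc t
  have hunit : ∀ t : ↥T, UnitaryGroup.conjLocal L (IsCMField.complexConj L) v (P * ((t : (UnitaryGroup.cmDatum L 2 (Matrix.of fun i j : Fin 2 => if i.val + j.val + 1 = 2 then (1 : L) else 0)).Local v × (UnitaryGroup.cmDatum L 1 (Matrix.of fun i j : Fin 1 => if i.val + j.val + 1 = 1 then (1 : L) else 0)).Local v).1.val : GL (Fin 2) (UnitaryGroup.LocalRing L v)).val).trace * (P * ((t : (UnitaryGroup.cmDatum L 2 (Matrix.of fun i j : Fin 2 => if i.val + j.val + 1 = 2 then (1 : L) else 0)).Local v × (UnitaryGroup.cmDatum L 1 (Matrix.of fun i j : Fin 1 => if i.val + j.val + 1 = 1 then (1 : L) else 0)).Local v).1.val : GL (Fin 2) (UnitaryGroup.LocalRing L v)).val).trace = 1 ∧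
      UnitaryGroup.conjLocal L (IsCMField.complexConj L) v ((1 - P) * ((t : (UnitaryGroup.cmDatum L 2 (Matrix.of fun i j : Fin 2 => if i.val + j.val + 1 = 2 then (1 : L) else 0)).Local v × (UnitaryGroup.cmDatum L 1 (Matrix.of fun i j : Fin 1 => if i.val + j.val + 1 = 1 then (1 : L) else 0)).Local v).1.val : GL (Fin 2) (UnitaryGroup.LocalRing L v)).val).trace * ((1 - P) * ((t : (UnitaryGroup.cmDatum L 2 (Matrix.of fun i j : Fin 2 => if i.val + j.val + 1 = 2 then (1 : L) else 0)).Local v × (UnitaryGroup.cmDatum L 1 (Matrix.of fun i j : Fin 1 => if i.val + j.val + 1 = 1 then (1 : L) else 0)).Local v).1.val : GL (Fin 2) (UnitaryGroup.LocalRing L v)).val).trace = 1 := by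
    intro t
    have hmem := mem_unitaryGroupOfForm_iff.1 ((t : (UnitaryGroup.cmDatum L 2 (Matrix.of fun i j : Fin 2 => if i.val + j.val + 1 = 2 then (1 : L) else 0)).Local v × (UnitaryGroup.cmDatum L 1 (Matrix.of fun i j : Fin 1 => if i.val + j.val + 1 = 1 then (1 : L) else 0)).Local v).1).2
    rw [hcoords t] at hmem
    exact mul_map_eq_one_of_unitary_smul_add_smul (UnitaryGroup.conjLocal L (IsCMField.complexConj L) v) (UnitaryGroup.cmLocalForm L 2 v) hP htrP hadj hJ hmem
  have hγ2 : ∀ a : (UnitaryGroup.cmDatum L 2 (Matrix.of fun i j : Fin 2 => if i.val + j.val + 1 = 2 then (1 : L) else 0)).Local v × (UnitaryGroup.cmDatum L 1 (Matrix.of fun i j : Fin 1 => if i.val + j.val + 1 = 1 then (1 : L) else 0)).Local v, UnitaryGroup.conjLocal L (IsCMField.complexConj L) v (finGammaTwo L v a) * finGammaTwo L v a = 1 := fun a => F0P3cStCharTSStableInvariantsH.conjLocal_finGammaTwo_mul_finGammaTwo' L v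
  have hγ2' : ∀ a : (UnitaryGroup.cmDatum L 2 (Matrix.of fun i j : Fin 2 => if i.val + j.val + 1 = 2 then (1 : L) else 0)).Local v × (UnitaryGroup.cmDatum L 1 (Matrix.of fun i j : Fin 1 => if i.val + j.val + 1 = 1 then (1 : L) else 0)).Local v, finGammaTwo L v a * UnitaryGroup.conjLocal L (IsCMField.complexConj L) v (finGammaTwo L v a) = 1 := fun a => by rw [mul_comm]; exact hγ2 a
  -- the `U(Φ₂)`-component of the image: `u P + β (1 − P)` as an invertible unitary matrix
  let M : ↥T → Matrix (Fin 2) (Fin 2) (UnitaryGroup.LocalRing L v) := fun t =>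
    finGammaTwo L v (t : (UnitaryGroup.cmDatum L 2 (Matrix.of fun i j : Fin 2 => if i.val + j.val + 1 = 2 then (1 : L) else 0)).Local v × (UnitaryGroup.cmDatum L 1 (Matrix.of fun i j : Fin 1 => if i.val + j.val + 1 = 1 then (1 : L) else 0)).Local v) • P + ((1 - P) * ((t : (UnitaryGroup.cmDatum L 2 (Matrix.of fun i j : Fin 2 => if i.val + j.val + 1 = 2 then (1 : L) else 0)).Local v × (UnitaryGroup.cmDatum L 1 (Matrix.of fun i j : Fin 1 => if i.val + j.val + 1 = 1 then (1 : L) else 0)).Local v).1.val : GL (Fin 2) (UnitaryGroup.LocalRing L v)).val).trace • (1 - P)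
  let M' : ↥T → Matrix (Fin 2) (Fin 2) (UnitaryGroup.LocalRing L v) := fun t =>
    UnitaryGroup.conjLocal L (IsCMField.complexConj L) v (finGammaTwo L v (t : (UnitaryGroup.cmDatum L 2 (Matrix.of fun i j : Fin 2 => if i.val + j.val + 1 = 2 then (1 : L) else 0)).Local v × (UnitaryGroup.cmDatum L 1 (Matrix.of fun i j : Fin 1 => if i.val + j.val + 1 = 1 then (1 : L) else 0)).Local v)) • P + UnitaryGroup.conjLocal L (IsCMField.complexConj L) v (((1 - P) * ((t : (UnitaryGroup.cmDatum L 2 (Matrix.of fun i j : Fin 2 => if i.val + j.val + 1 = 2 then (1 : L) else 0)).Local v × (UnitaryGroup.cmDatum L 1 (Matrix.of fun i j : Fin 1 => if i.val + j.val + 1 = 1 then (1 : L) else 0)).Local v).1.val : GL (Fin 2) (UnitaryGroup.LocalRing L v)).val).trace) • (1 - P)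
  have hMM' : ∀ t, M t * M' t = 1 := fun t => smul_add_smul_mul_eq_one hP (hγ2' _) (by rw [mul_comm]; exact (hunit t).2)
  have hM'M : ∀ t, M' t * M t = 1 := fun t => smul_add_smul_mul_eq_one hP (hγ2 _) (hunit t).2
  let U : ↥T → GL (Fin 2) (UnitaryGroup.LocalRing L v) := fun t => ⟨M t, M' t, hMM' t, hM'M t⟩
  have hUmem : ∀ t, U t ∈ unitaryGroupOfForm (UnitaryGroup.conjLocal L (IsCMField.complexConj L) v) (UnitaryGroup.cmLocalForm L 2 v) := fun t =>
    mem_unitaryGroupOfForm_iff.2 (unitary_smul_add_smul (UnitaryGroup.conjLocal L (IsCMField.complexConj L) v) (UnitaryGroup.cmLocalForm L 2 v) hP hadj (hγ2 _) (hunit t).2)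
  -- the `U(Φ₁)`-component: the scalar `α`
  let W : ↥T → GL (Fin 1) (UnitaryGroup.LocalRing L v) := fun t =>
    ⟨(P * ((t : (UnitaryGroup.cmDatum L 2 (Matrix.of fun i j : Fin 2 => if i.val + j.val + 1 = 2 then (1 : L) else 0)).Local v × (UnitaryGroup.cmDatum L 1 (Matrix.of fun i j : Fin 1 => if i.val + j.val + 1 = 1 then (1 : L) else 0)).Local v).1.val : GL (Fin 2) (UnitaryGroup.LocalRing L v)).val).trace • (1 : Matrix (Fin 1) (Fin 1) (UnitaryGroup.LocalRing L v)),
     UnitaryGroup.conjLocal L (IsCMField.complexConj L) v ((P * ((t : (UnitaryGroup.cmDatum L 2 (Matrix.of fun i j : Fin 2 => if i.val + j.val + 1 = 2 then (1 : L) else 0)).Local v × (UnitaryGroup.cmDatum L 1 (Matrix.of fun i j : Fin 1 => if i.val + j.val + 1 = 1 then (1 : L) else 0)).Local v).1.val : GL (Fin 2) (UnitaryGroup.LocalRing L v)).val).trace) • (1 : Matrix (Fin 1) (Fin 1) (UnitaryGroup.LocalRing L v)),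
     by rw [smul_mul_smul_comm, one_mul, mul_comm, (hunit t).1, one_smul],
     by rw [smul_mul_smul_comm, one_mul, (hunit t).1, one_smul]⟩
  have hWmem : ∀ t, W t ∈ unitaryGroupOfForm (UnitaryGroup.conjLocal L (IsCMField.complexConj L) v) (UnitaryGroup.cmLocalForm L 1 v) := fun t => smul_one_mem_local_one (hunit t).1 (W t) rfl
  -- the image point and its membership in `T` (it commutes with `γ₀`: both `U(Φ₂)`-parts lie in the commutative span of `P`, `1 − P`)
  let F₀ : ↥T → (UnitaryGroup.cmDatum L 2 (Matrix.of fun i j : Fin 2 => if i.val + j.val + 1 = 2 then (1 : L) else 0)).Local v × (UnitaryGroup.cmDatum L 1 (Matrix.of fun i j : Fin 1 => if i.val + j.val + 1 = 1 then (1 : L) else 0)).Local v := fun t => (⟨U t, hUmem t⟩, ⟨W t, hWmem t⟩)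
  have hg := eq_trace_smul_add_trace_smul_of_commute hP htrP hPg.symm
  have hF₀mem : ∀ t, F₀ t ∈ T := by
    intro t
    rw [hT, Subgroup.mem_centralizer_singleton_iff]
    refine Prod.ext ?_ ?_
    swap
    · apply Subtype.ext
      apply Units.ext
      change (W t).val * (γ₀.2.val : GL (Fin 1) (UnitaryGroup.LocalRing L v)).val = (γ₀.2.val : GL (Fin 1) (UnitaryGroup.LocalRing L v)).val * (W t).val
      rw [snd_val_eq_smul_one γ₀]
      change ((P * ((t : (UnitaryGroup.cmDatum L 2 (Matrix.of fun i j : Fin 2 => if i.val + j.val + 1 = 2 then (1 : L) else 0)).Local v × (UnitaryGroup.cmDatum L 1 (Matrix.of fun i j : Fin 1 => if i.val + j.val + 1 = 1 then (1 : L) else 0)).Local v).1.val : GL (Fin 2) (UnitaryGroup.LocalRing L v)).val).trace • (1 : Matrix (Fin 1) (Fin 1) (UnitaryGroup.LocalRing L v))) * (finGammaTwo L v γ₀ • (1 : Matrix (Fin 1) (Fin 1) (UnitaryGroup.LocalRing L v))) =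
        (finGammaTwo L v γ₀ • (1 : Matrix (Fin 1) (Fin 1) (UnitaryGroup.LocalRing L v))) * ((P * ((t : (UnitaryGroup.cmDatum L 2 (Matrix.of fun i j : Fin 2 => if i.val + j.val + 1 = 2 then (1 : L) else 0)).Local v × (UnitaryGroup.cmDatum L 1 (Matrix.of fun i j : Fin 1 => if i.val + j.val + 1 = 1 then (1 : L) else 0)).Local v).1.val : GL (Fin 2) (UnitaryGroup.LocalRing L v)).val).trace • (1 : Matrix (Fin 1) (Fin 1) (UnitaryGroup.LocalRing L v)))
      rw [smul_mul_smul_comm, smul_mul_smul_comm, mul_comm]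
    apply Subtype.ext
    apply Units.ext
    change M t * (γ₀.1.val : GL (Fin 2) (UnitaryGroup.LocalRing L v)).val = (γ₀.1.val : GL (Fin 2) (UnitaryGroup.LocalRing L v)).val * M t
    rw [hg]
    simp only [M, smul_add_smul_mul_smul_add_smul hP, mul_comm]
  let F : ↥T → ↥T := fun t => ⟨F₀ t, hF₀mem t⟩
  -- reading the coordinates of the image
  have hF1 : ∀ t, (((F t : ↥T) : (UnitaryGroup.cmDatum L 2 (Matrix.of fun i j : Fin 2 => if i.val + j.val + 1 = 2 then (1 : L) else 0)).Local v × (UnitaryGroup.cmDatum L 1 (Matrix.of fun i j : Fin 1 => if i.val + j.val + 1 = 1 then (1 : L) else 0)).Local v).1.val : GL (Fin 2) (UnitaryGroup.LocalRing L v)).val = M t := fun t => rfl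
  have hF2 : ∀ t, finGammaTwo L v ((F t : ↥T) : (UnitaryGroup.cmDatum L 2 (Matrix.of fun i j : Fin 2 => if i.val + j.val + 1 = 2 then (1 : L) else 0)).Local v × (UnitaryGroup.cmDatum L 1 (Matrix.of fun i j : Fin 1 => if i.val + j.val + 1 = 1 then (1 : L) else 0)).Local v) = (P * ((t : (UnitaryGroup.cmDatum L 2 (Matrix.of fun i j : Fin 2 => if i.val + j.val + 1 = 2 then (1 : L) else 0)).Local v × (UnitaryGroup.cmDatum L 1 (Matrix.of fun i j : Fin 1 => if i.val + j.val + 1 = 1 then (1 : L) else 0)).Local v).1.val : GL (Fin 2) (UnitaryGroup.LocalRing L v)).val).trace := by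
    intro t
    show ((P * ((t : (UnitaryGroup.cmDatum L 2 (Matrix.of fun i j : Fin 2 => if i.val + j.val + 1 = 2 then (1 : L) else 0)).Local v × (UnitaryGroup.cmDatum L 1 (Matrix.of fun i j : Fin 1 => if i.val + j.val + 1 = 1 then (1 : L) else 0)).Local v).1.val : GL (Fin 2) (UnitaryGroup.LocalRing L v)).val).trace • (1 : Matrix (Fin 1) (Fin 1) (UnitaryGroup.LocalRing L v))) 0 0 = _
    simp
  have hFα : ∀ t, (P * (((F t : ↥T) : (UnitaryGroup.cmDatum L 2 (Matrix.of fun i j : Fin 2 => if i.val + j.val + 1 = 2 then (1 : L) else 0)).Local v × (UnitaryGroup.cmDatum L 1 (Matrix.of fun i j : Fin 1 => if i.val + j.val + 1 = 1 then (1 : L) else 0)).Local v).1.val : GL (Fin 2) (UnitaryGroup.LocalRing L v)).val).trace = finGammaTwo L v (t : (UnitaryGroup.cmDatum L 2 (Matrix.of fun i j : Fin 2 => if i.val + j.val + 1 = 2 then (1 : L) else 0)).Local v × (UnitaryGroup.cmDatum L 1 (Matrix.of fun i j : Fin 1 => if i.val + j.val + 1 = 1 then (1 : L) else 0)).Local v)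 := fun t => by
    rw [hF1]; exact (trace_idem_mul_smul_add_smul hP htrP _ _).1
  have hFβ : ∀ t, ((1 - P) * (((F t : ↥T) : (UnitaryGroup.cmDatum L 2 (Matrix.of fun i j : Fin 2 => if i.val + j.val + 1 = 2 then (1 : L) else 0)).Local v × (UnitaryGroup.cmDatum L 1 (Matrix.of fun i j : Fin 1 => if i.val + j.val + 1 = 1 then (1 : L) else 0)).Local v).1.val : GL (Fin 2) (UnitaryGroup.LocalRing L v)).val).trace = ((1 - P) * ((t : (UnitaryGroup.cmDatum L 2 (Matrix.of fun i j : Fin 2 => if i.val + j.val + 1 = 2 then (1 : L) else 0)).Local v × (UnitaryGroup.cmDatum L 1 (Matrix.of fun i j : Fin 1 => if i.val + j.val + 1 = 1 then (1 : L) else 0)).Local v).1.val : GL (Fin 2) (UnitaryGroup.LocalRing L v)).val).trace :=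
    fun t => by rw [hF1]; exact (trace_idem_mul_smul_add_smul hP htrP _ _).2
  -- involution
  have hFF : ∀ t, F (F t) = t := by
    intro t
    apply Subtype.ext
    refine Prod.ext ?_ ?_
    · apply Subtype.ext; apply Units.ext
      change M (F t) = ((t : (UnitaryGroup.cmDatum L 2 (Matrix.of fun i j : Fin 2 => if i.val + j.val + 1 = 2 then (1 : L) else 0)).Local v × (UnitaryGroup.cmDatum L 1 (Matrix.of fun i j : Fin 1 => if i.val + j.val + 1 = 1 then (1 : L) else 0)).Local v).1.val : GL (Fin 2) (UnitaryGroup.LocalRing L v)).val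
      simp only [M]
      rw [hF2, hFβ, ← hcoords t]
    · apply Subtype.ext; apply Units.ext
      change (P * (((F t : ↥T) : (UnitaryGroup.cmDatum L 2 (Matrix.of fun i j : Fin 2 => if i.val + j.val + 1 = 2 then (1 : L) else 0)).Local v × (UnitaryGroup.cmDatum L 1 (Matrix.of fun i j : Fin 1 => if i.val + j.val + 1 = 1 then (1 : L) else 0)).Local v).1.val : GL (Fin 2) (UnitaryGroup.LocalRing L v)).val).trace • (1 : Matrix (Fin 1) (Fin 1) (UnitaryGroup.LocalRing L v)) = ((t : (UnitaryGroup.cmDatum L 2 (Matrix.of fun i j : Fin 2 => if i.val + j.val + 1 = 2 then (1 : L) else 0)).Local v × (UnitaryGroup.cmDatum L 1 (Matrix.of fun i j : Fin 1 => if i.val + j.val + 1 = 1 then (1 : L) else 0)).Local v).2.val : GL (Fin 1) (UnitaryGroup.LocalRing L v)).val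
      rw [hFα, snd_val_eq_smul_one]
  -- multiplicativity
  have hmulcoord : ∀ t t' : ↥T,
      (P * (((t * t' : ↥T) : (UnitaryGroup.cmDatum L 2 (Matrix.of fun i j : Fin 2 => if i.val + j.val + 1 = 2 then (1 : L) else 0)).Local v × (UnitaryGroup.cmDatum L 1 (Matrix.of fun i j : Fin 1 => if i.val + j.val + 1 = 1 then (1 : L) else 0)).Local v).1.val : GL (Fin 2) (UnitaryGroup.LocalRing L v)).val).trace = (P * ((t : (UnitaryGroup.cmDatum L 2 (Matrix.of fun i j : Fin 2 => if i.val + j.val + 1 = 2 then (1 : L) else 0)).Local v × (UnitaryGroup.cmDatum L 1 (Matrix.of fun i j : Fin 1 => if i.val + j.val + 1 = 1 then (1 : L) else 0)).Local v).1.val : GL (Fin 2) (UnitaryGroup.LocalRing L v)).val).trace * (P * ((t' : (UnitaryGroup.cmDatum L 2 (Matrix.of fun i j : Fin 2 => if i.val + j.val + 1 = 2 then (1 : L) else 0)).Local v × (UnitaryGroup.cmDatum L 1 (Matrix.of fun i j : Fin 1 => if i.val + j.val + 1 = 1 then (1 : L) else 0)).Local v).1.val : GL (Fin 2) (UnitaryGroup.LocalRing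 L v)).val).trace ∧
      ((1 - P) * (((t * t' : ↥T) : (UnitaryGroup.cmDatum L 2 (Matrix.of fun i j : Fin 2 => if i.val + j.val + 1 = 2 then (1 : L) else 0)).Local v × (UnitaryGroup.cmDatum L 1 (Matrix.of fun i j : Fin 1 => if i.val + j.val + 1 = 1 then (1 : L) else 0)).Local v).1.val : GL (Fin 2) (UnitaryGroup.LocalRing L v)).val).trace =
        ((1 - P) * ((t : (UnitaryGroup.cmDatum L 2 (Matrix.of fun i j : Fin 2 => if i.val + j.val + 1 = 2 then (1 : L) else 0)).Local v × (UnitaryGroup.cmDatum L 1 (Matrix.of fun i j : Fin 1 => if i.val + j.val + 1 = 1 then (1 : L) else 0)).Local v).1.val : GL (Fin 2) (UnitaryGroup.LocalRing L v)).val).trace * ((1 - P) * ((t' : (UnitaryGroup.cmDatum L 2 (Matrix.of fun i j : Fin 2 => if i.val + j.val + 1 = 2 then (1 : L) else 0)).Local v × (UnitaryGroup.cmDatum L 1 (Matrix.of fun i j : Fin 1 => if i.val + j.val + 1 = 1 then (1 : L) else 0)).Local v).1.val : GL (Fin 2) (UnitaryGroup.LocalRing L v)).val).trace := by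
    intro t t'
    have hprod : (((t * t' : ↥T) : (UnitaryGroup.cmDatum L 2 (Matrix.of fun i j : Fin 2 => if i.val + j.val + 1 = 2 then (1 : L) else 0)).Local v × (UnitaryGroup.cmDatum L 1 (Matrix.of fun i j : Fin 1 => if i.val + j.val + 1 = 1 then (1 : L) else 0)).Local v).1.val : GL (Fin 2) (UnitaryGroup.LocalRing L v)).val = ((t : (UnitaryGroup.cmDatum L 2 (Matrix.of fun i j : Fin 2 => if i.val + j.val + 1 = 2 then (1 : L) else 0)).Local v × (UnitaryGroup.cmDatum L 1 (Matrix.of fun i j : Fin 1 => if i.val + j.val + 1 = 1 then (1 : L) else 0)).Local v).1.val : GL (Fin 2) (UnitaryGroup.LocalRing L v)).val * ((t' : (UnitaryGroup.cmDatum L 2 (Matrix.of fun i j : Fin 2 => if i.val + j.val + 1 = 2 then (1 : L) else 0)).Local v × (UnitaryGroup.cmDatum L 1 (Matrix.of fun i j : Fin 1 => if i.val + j.val + 1 = 1 then (1 : L) else 0)).Local v).1.val : GL (Fin 2) (UnitaryGroup.LocalRing L v)).val := rfl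
    have hexp : ((t : (UnitaryGroup.cmDatum L 2 (Matrix.of fun i j : Fin 2 => if i.val + j.val + 1 = 2 then (1 : L) else 0)).Local v × (UnitaryGroup.cmDatum L 1 (Matrix.of fun i j : Fin 1 => if i.val + j.val + 1 = 1 then (1 : L) else 0)).Local v).1.val : GL (Fin 2) (UnitaryGroup.LocalRing L v)).val * ((t' : (UnitaryGroup.cmDatum L 2 (Matrix.of fun i j : Fin 2 => if i.val + j.val + 1 = 2 then (1 : L) else 0)).Local v × (UnitaryGroup.cmDatum L 1 (Matrix.of fun i j : Fin 1 => if i.val + j.val + 1 = 1 then (1 : L) else 0)).Local v).1.val : GL (Fin 2) (UnitaryGroup.LocalRing L v)).val =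
        ((P * ((t : (UnitaryGroup.cmDatum L 2 (Matrix.of fun i j : Fin 2 => if i.val + j.val + 1 = 2 then (1 : L) else 0)).Local v × (UnitaryGroup.cmDatum L 1 (Matrix.of fun i j : Fin 1 => if i.val + j.val + 1 = 1 then (1 : L) else 0)).Local v).1.val : GL (Fin 2) (UnitaryGroup.LocalRing L v)).val).trace * (P * ((t' : (UnitaryGroup.cmDatum L 2 (Matrix.of fun i j : Fin 2 => if i.val + j.val + 1 = 2 then (1 : L) else 0)).Local v × (UnitaryGroup.cmDatum L 1 (Matrix.of fun i j : Fin 1 => if i.val + j.val + 1 = 1 then (1 : L) else 0)).Local v).1.val : GL (Fin 2) (UnitaryGroup.LocalRing L v)).val).trace) • P +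
          (((1 - P) * ((t : (UnitaryGroup.cmDatum L 2 (Matrix.of fun i j : Fin 2 => if i.val + j.val + 1 = 2 then (1 : L) else 0)).Local v × (UnitaryGroup.cmDatum L 1 (Matrix.of fun i j : Fin 1 => if i.val + j.val + 1 = 1 then (1 : L) else 0)).Local v).1.val : GL (Fin 2) (UnitaryGroup.LocalRing L v)).val).trace * ((1 - P) * ((t' : (UnitaryGroup.cmDatum L 2 (Matrix.of fun i j : Fin 2 => if i.val + j.val + 1 = 2 then (1 : L) else 0)).Local v × (UnitaryGroup.cmDatum L 1 (Matrix.of fun i j : Fin 1 => if i.val + j.val + 1 = 1 then (1 : L) else 0)).Local v).1.val : GL (Fin 2) (UnitaryGroup.LocalRing L v)).val).trace) • (1 - P) := by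
      conv_lhs => rw [hcoords t, hcoords t']
      exact smul_add_smul_mul_smul_add_smul hP _ _ _ _
    rw [hprod, hexp]
    exact trace_idem_mul_smul_add_smul hP htrP _ _
  have hcmul : ∀ t t' : ↥T, finGammaTwo L v ((t * t' : ↥T) : (UnitaryGroup.cmDatum L 2 (Matrix.of fun i j : Fin 2 => if i.val + j.val + 1 = 2 then (1 : L) else 0)).Local v × (UnitaryGroup.cmDatum L 1 (Matrix.of fun i j : Fin 1 => if i.val + j.val + 1 = 1 then (1 : L) else 0)).Local v) = finGammaTwo L v (t : (UnitaryGroup.cmDatum L 2 (Matrix.of fun i j : Fin 2 => if i.val + j.val + 1 = 2 then (1 : L) else 0)).Local v × (UnitaryGroup.cmDatum L 1 (Matrix.of fun i j : Fin 1 => if i.val + j.val + 1 = 1 then (1 : L) else 0)).Local v) * finGammaTwo L v (t' : (UnitaryGroup.cmDatum L 2 (Matrix.of fun i j : Fin 2 => if i.val + j.val + 1 = 2 then (1 : L) else 0)).Local v × (UnitaryGroup.cmDatum L 1 (Matrix.of fun i j : Fin 1 => if i.val + j.val + 1 = 1 then (1 : L) else 0)).Local v) := by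
    intro t t'
    have h : ((((t * t' : ↥T) : (UnitaryGroup.cmDatum L 2 (Matrix.of fun i j : Fin 2 => if i.val + j.val + 1 = 2 then (1 : L) else 0)).Local v × (UnitaryGroup.cmDatum L 1 (Matrix.of fun i j : Fin 1 => if i.val + j.val + 1 = 1 then (1 : L) else 0)).Local v).2.val : GL (Fin 1) (UnitaryGroup.LocalRing L v)).val : Matrix (Fin 1) (Fin 1) (UnitaryGroup.LocalRing L v)) =
        ((t : (UnitaryGroup.cmDatum L 2 (Matrix.of fun i j : Fin 2 => if i.val + j.val + 1 = 2 then (1 : L) else 0)).Local v × (UnitaryGroup.cmDatum L 1 (Matrix.of fun i j : Fin 1 => if i.val + j.val + 1 = 1 then (1 : L) else 0)).Local v).2.val : GL (Fin 1) (UnitaryGroup.LocalRing L v)).val * ((t' : (UnitaryGroup.cmDatum L 2 (Matrix.of fun i j : Fin 2 => if i.val + j.val + 1 = 2 then (1 : L) else 0)).Local v × (UnitaryGroup.cmDatum L 1 (Matrix.of fun i j : Fin 1 => if i.val + j.val + 1 = 1 then (1 : L) else 0)).Local v).2.val : GL (Fin 1) (UnitaryGroup.LocalRing L v)).val := rfl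
    unfold finGammaTwo
    rw [h, Matrix.mul_apply, Fin.sum_univ_one]
  have hFmul : ∀ t t', F (t * t') = F t * F t' := by
    intro t t'
    apply Subtype.ext
    refine Prod.ext ?_ ?_
    · apply Subtype.ext; apply Units.ext
      change M (t * t') = M t * M t'
      simp only [M]
      rw [smul_add_smul_mul_smul_add_smul hP, (hmulcoord t t').2, hcmul]
    · apply Subtype.ext; apply Units.ext
      change (P * (((t * t' : ↥T) : (UnitaryGroup.cmDatum L 2 (Matrix.of fun i j : Fin 2 => if i.val + j.val + 1 = 2 then (1 : L) else 0)).Local v × (UnitaryGroup.cmDatum L 1 (Matrix.of fun i j : Fin 1 => if i.val + j.val + 1 = 1 then (1 : L) else 0)).Local v).1.val : GL (Fin 2) (UnitaryGroup.LocalRing L v)).val).trace • (1 : Matrix (Fin 1) (Fin 1) (UnitaryGroup.LocalRing L v)) =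
        ((P * ((t : (UnitaryGroup.cmDatum L 2 (Matrix.of fun i j : Fin 2 => if i.val + j.val + 1 = 2 then (1 : L) else 0)).Local v × (UnitaryGroup.cmDatum L 1 (Matrix.of fun i j : Fin 1 => if i.val + j.val + 1 = 1 then (1 : L) else 0)).Local v).1.val : GL (Fin 2) (UnitaryGroup.LocalRing L v)).val).trace • (1 : Matrix (Fin 1) (Fin 1) (UnitaryGroup.LocalRing L v))) *
          ((P * ((t' : (UnitaryGroup.cmDatum L 2 (Matrix.of fun i j : Fin 2 => if i.val + j.val + 1 = 2 then (1 : L) else 0)).Local v × (UnitaryGroup.cmDatum L 1 (Matrix.of fun i j : Fin 1 => if i.val + j.val + 1 = 1 then (1 : L) else 0)).Local v).1.val : GL (Fin 2) (UnitaryGroup.LocalRing L v)).val).trace • (1 : Matrix (Fin 1) (Fin 1) (UnitaryGroup.LocalRing L v)))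
      rw [(hmulcoord t t').1, smul_mul_smul_comm, one_mul]
  -- continuity
  have hc1 : Continuous fun t : ↥T => ((t : (UnitaryGroup.cmDatum L 2 (Matrix.of fun i j : Fin 2 => if i.val + j.val + 1 = 2 then (1 : L) else 0)).Local v × (UnitaryGroup.cmDatum L 1 (Matrix.of fun i j : Fin 1 => if i.val + j.val + 1 = 1 then (1 : L) else 0)).Local v).1.val : GL (Fin 2) (UnitaryGroup.LocalRing L v)).val :=
    Units.continuous_val.comp (continuous_subtype_val.comp (continuous_fst.comp continuous_subtype_val))
  have hc2 : Continuous fun t : ↥T => finGammaTwo L v (t : (UnitaryGroup.cmDatum L 2 (Matrix.of fun i j : Fin 2 => if i.val + j.val + 1 = 2 then (1 : L) else 0)).Local v × (UnitaryGroup.cmDatum L 1 (Matrix.of fun i j : Fin 1 => if i.val + j.val + 1 = 1 then (1 : L) else 0)).Local v) := by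
    have h := Units.continuous_val.comp (continuous_subtype_val.comp (continuous_snd.comp (continuous_subtype_val (p := fun x => x ∈ T))))
    exact (Continuous.matrix_elem h 0 0)
  have hcα : Continuous fun t : ↥T => (P * ((t : (UnitaryGroup.cmDatum L 2 (Matrix.of fun i j : Fin 2 => if i.val + j.val + 1 = 2 then (1 : L) else 0)).Local v × (UnitaryGroup.cmDatum L 1 (Matrix.of fun i j : Fin 1 => if i.val + j.val + 1 = 1 then (1 : L) else 0)).Local v).1.val : GL (Fin 2) (UnitaryGroup.LocalRing L v)).val).trace := (continuous_const.matrix_mul hc1).matrix_trace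
  have hcβ : Continuous fun t : ↥T => ((1 - P) * ((t : (UnitaryGroup.cmDatum L 2 (Matrix.of fun i j : Fin 2 => if i.val + j.val + 1 = 2 then (1 : L) else 0)).Local v × (UnitaryGroup.cmDatum L 1 (Matrix.of fun i j : Fin 1 => if i.val + j.val + 1 = 1 then (1 : L) else 0)).Local v).1.val : GL (Fin 2) (UnitaryGroup.LocalRing L v)).val).trace := (continuous_const.matrix_mul hc1).matrix_trace
  have hσc := continuous_conjLocal L (IsCMField.complexConj L) v
  have hcM : Continuous M := (hc2.smul continuous_const).add (hcβ.smul continuous_const)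
  have hcM' : Continuous M' := ((hσc.comp hc2).smul continuous_const).add ((hσc.comp hcβ).smul continuous_const)
  have hcU : Continuous U := Units.continuous_iff.2 ⟨hcM, hcM'⟩
  have hcW : Continuous W := Units.continuous_iff.2 ⟨hcα.smul continuous_const, (hσc.comp hcα).smul continuous_const⟩
  have hcF₀ : Continuous F₀ := (hcU.subtype_mk _).prodMk (hcW.subtype_mk _)
  have hcF : Continuous F := hcF₀.subtype_mk _
  -- assemble
  refine ⟨{ toFun := F, invFun := F, left_inv := hFF, right_inv := hFF, map_mul' := hFmul, continuous_toFun := hcF, continuous_invFun := hcF }, fun t => ⟨hF1 t, hF2 t⟩⟩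

end Swap

end Summit.HodgeConjecture.HodgeConjecture.Cruxes.H413.F0P3cStCharTSEllInnerSlotCoords

end
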